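import Mathlib
import HarnessLib
import Literature.NumberTheory.LFunctions.CriticalLineTwoThirds
import Literature.NumberTheory.LFunctions.GaborCriticalDensityPoisson

/-!
# RH-FREE — «nothing here bears on the truth of RH»: the compressed Weil form `G̃ = P + Q` of Alpöge–Furman 2026 (arXiv:2608.13637, §§2.2–2.3) as CONCRETE definitions, and the two analytic evaluations that §6 consumes — Proposition 4.2 (trace) and Theorem 5.7 (Hilbert–Schmidt norm) — typed AS PRINTED as claims of an unrefereed preprint

Topic `Literature/NumberTheory/LFunctions` (namespace `Literature.NumberTheory.LFunctions`; the
objects in the sub-namespace `AlpogeFurman2026`, next to `AlpogeFurman2026.hat` / `.grid` of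
`GaborCriticalDensityPoisson.lean`). STATEMENT LAYER (D-0014), cell `rh-columns/lit`, tranche 1
(unit `rh-lit-frontier-1`, gen 6), for

* **[AF26]** L. Alpöge, R. Furman, *More than two thirds of the zeros of the Riemann zeta function
  are simple and on the critical line*, arXiv:2608.13637v2 (19 Aug 2026), 21 pp. UNREFEREED
  (D-0012). Locators = printed pages of v2 (TeX of record `paper-v5-draft18.tex` of the arXiv
  e-print; PDF text `paper:arxiv-2608.13637`).

## Why this file exists

The statement file `CriticalLineTwoThirds.lean` types Theorems A/B, Lemma 3.2, Lemma 5.6 and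
Remarks 6.1/7.1; sibling proof files make EVERY LEMMA of [AF26] and the finite-dimensional
skeleton of §§3, 4.1, 6 kernel theorems — but ABSTRACTLY: over index types `ι₁, ι₂, κ` and given
vectors (`AlpogeFurman2026_simple_chain_i/_ii`, `AlpogeFurman2026_block_certificate`). What the tree
did not have is the CONCRETE apparatus of §§2.2–2.3 — the ramp `χ`, the test function `φ`, the
normalisation `a`, the dimension `d`, the vectors `v_ρ`, the matrices `G̃, P, Q` — and hence none of
the numbered statements that mention it (Propositions 4.1–4.3, Corollary 4.5, Propositions 5.2–5.5,
Theorem 5.7). This file supplies the definitions (real bodies, no stubs) and types the two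
statements the proof of Theorem A (§6, p. 12) actually CONSUMES:

* **Proposition 4.2 (Trace)** (p. 6): `tr G̃ = N(I′) + O_χ(T^{1/2} L²)` — `AlpogeFurman2026_trace`;
* **Theorem 5.7** (p. 11): `‖G̃‖²_HS = (R(ψ) + O_χ(L⁻¹)) N(T,2T)` — `AlpogeFurman2026_hilbertSchmidt`.

Both are typed as CLAIMS (`[claim: AlpogeFurman2026, status: under-review]`), consumed as
hypotheses, never asserted. UPDATE: Proposition 4.2 is now PROVED for this typed model in the
companion file `CriticalLineTwoThirdsTraceProofs.lean` (`AlpogeFurman2026_trace_holds :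
AlpogeFurman2026_trace`, RH-free Fourier analysis + explicit zero counting), and — UPDATE (gen 8) —
so is Theorem 5.7: `AlpogeFurman2026_hilbertSchmidt_holds : AlpogeFurman2026_hilbertSchmidt` in
`CriticalLineTwoThirdsHilbertSchmidtProofs.lean` (the printed proof through Propositions 5.2–5.5,
files `…Reduction`, `…ArchProofs`, `…PrimeTermProofs`). The companion proof file
`CriticalLineTwoThirdsMatrixProofs.lean` PROVES, over these definitions, Proposition 4.1 (block
structure), Corollary 4.5, and the §6 assembly
`AlpogeFurman2026_trace → AlpogeFurman2026_hilbertSchmidt → Theorem A` (both parts, every window);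
with both inputs proved, the typed `ζ`-claims of `CriticalLineTwoThirds.lean` are discharged in
`CriticalLineTwoThirdsTheoremAProofs.lean` (kernel facts of this tree about the typed objects below
and the tree's zero counts; no endorsement of the source; nothing here bears on the truth of RH).

## What the source prints (§§2.2–2.3, 4, 5; pp. 4–11)

* §1.7: `f̂(ξ) = ∫ f(u) e^{−iuξ} du`; `n₊(R)` = number of strictly positive eigenvalues;
  `‖R‖²_HS = tr R²`; `l := log(T/2π)`.
* §2.2 (p. 4): "Fix an even window `ψ ∈ C²([−½,½])` with `ψ > 0` on `[−½,½]`" (the two choices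
  `ψ₀ = 1_{[−½,½]}`, `ψ_MT(s) = cos(√2 s) 1_{[−½,½]}(s)`, (2.7)). "Fix `χ ∈ C^∞(ℝ)` nondecreasing,
  `χ|_{(−∞,0]} = 0`, `χ|_{[1,∞)} = 1`. With `L := l = log(T/2π)` and `X := e^L = T/2π`, set
  `φ(u) := χ(L/2 + u) χ(L/2 − u) · ψ(u/L)^{1/2}` (2.8). Then `φ ∈ C²_c(ℝ)` is even, `0 ≤ φ ≤ 1`,
  `supp φ = [−L/2, L/2]` …". "Place `α_k := T + 2πk/L` for `k ∈ ℤ` and `d := ⌊LT/(2π)⌋`, so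
  `α_0,…,α_{d−1} ∈ [T,2T)` and `d = N(T,2T) + O(L)`. For a zero `ρ` set
  `v_ρ := (φ̂(γ_ρ − α_k))_{0≤k<d} ∈ ℂ^d` (2.10)", `γ_ρ = (ρ − ½)/i` (§1.2).
* §2.3 (p. 4): "Let `I := [T,2T)`, `I′ := [T − √T, 2T + √T)`, and partition the zeros with
  `Re γ_ρ ∈ I′` into `on := {ρ : β = ½}`, `off := {ρ : β ≠ ½}`. Put `a := ‖φ‖₂²/L` … and define the
  real symmetric `d × d` matrices `G̃ := (aL²)⁻¹ Σ_{Re γ_ρ ∈ I′} m_ρ v_ρ v_ρᵀ`,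
  `P := (aL²)⁻¹ Σ_{ρ ∈ on} m_ρ v_ρ v_ρᵀ`, `Q := G̃ − P`" (2.11), "and
  `Ẽ := (aL²)⁻¹ Σ_{Re γ_ρ ∉ I′} m_ρ v_ρ v_ρᵀ`. … The functional equation pairs `off` as `{ρ, 1 − ρ̄}`
  with `v_{1−ρ̄} = v̄_ρ`, so `G̃, Ẽ` are real symmetric."
* §4 (p. 6): "Throughout §§4–6 the implied constants depend only on `χ` and `ψ`, and we take `T`
  large." **Proposition 4.1 (Block structure).** "`P ⪰ 0` with `rank P ≤ N₀^*(I′)` and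
  `tr P ≤ N₀(I′)`; and `n₊(Q) ≤ ½ #off`." **Proposition 4.2 (Trace).**
  "`tr G̃ = N(I′) + O_χ(T^{1/2} L²)`." **Proposition 4.3 (Tail)** (p. 7). "`‖Ẽ‖₁ ≪_χ T^{−1/2}`; in
  particular `‖Ẽ‖, ‖Ẽ‖_HS ≤ ‖Ẽ‖₁ = o(1)`." **Corollary 4.5** (p. 7).
  "`tr P + 2n₊(Q) ≤ N(I) + O(√T log T)`, and `N₀^*(I) ≥ rank P − O(√T log T)`."
* §5 (pp. 7–11): Propositions 5.2 (reduction to the double integral `𝓜`), 5.3 (archimedean term),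
  5.4 (prime term), 5.5 (cross terms), Lemma 5.6 (`R(ψ)`, typed in `CriticalLineTwoThirds.lean` as
  `windowConstant`), and **Theorem 5.7** (p. 11): "`‖G̃‖²_HS = (R(ψ) + O_χ(L⁻¹)) N(T,2T)`."
* §6 (p. 12) consumes exactly: Proposition 4.1 / Lemma 2.1 (`P₁ ⪰ 0`, `rank P₁ ≤ s₁`, `tr P₁ ≤ s₁`,
  `n₊(Q′) ≤ s₂ + p`), Lemma 3.2, `s₁ + 2s₂ + 2p ≤ N(I′)`, Proposition 4.2, Theorem 5.7,
  `N(I′) = N(I) + O(D₀L)`, `N₀^s(I) = s₁ − O(D₀L)` (`D₀ = T^{1/2}`).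

## Lean rendering

* The ramp. [AF26] fixes an ARBITRARY `χ ∈ C^∞`, nondecreasing, `0` on `(−∞,0]`, `1` on `[1,∞)`, and
  lets every constant depend on it. We INSTANTIATE `χ := Real.smoothTransition` (`smoothRamp`), which
  Mathlib proves has exactly these properties (`Real.smoothTransition.zero_of_nonpos`,
  `.one_of_one_le`, `.monotone`, `.contDiff`); every statement below is therefore the printed one for
  this admissible `χ`, and the typed constants are the printed `O_χ`-constants at this `χ`.
* The window enters only through its values on `[−½, ½]` (as in `windowConstant`): `phi ψ T` reads
  `ψ` through the clamp `clampHalf (u/L) ∈ [−½, ½]`; since the ramp factor vanishes identically for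
  `|u| ≥ L/2`, this is POINTWISE the printed `φ` (`phi_eq_printed`), and it spares every user a
  hypothesis on `ψ` off `[−½,½]`. `IsWindow ψ` = "even, `C²` on `[−½,½]`, `> 0` there".
* `L = logHeight T = log(T/2π)`, `a = aConst ψ T = (∫ φ²)/L`, `d = gridDim T = ⌊L T/2π⌋₊`,
  `α_k = AlpogeFurman2026.grid T L k`, `φ̂ = AlpogeFurman2026.hat`, `γ_ρ = gammaOf ρ = (ρ − ½)/i`,
  `v_ρ = zeroVec ψ T ρ : Fin d → ℂ`, `v_ρ v_ρᵀ = vecMulVec v_ρ v_ρ` (transpose, NOT conjugate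
  transpose, as printed).
* The zeros with `Re γ_ρ ∈ I′` are `nearZeros T = {ρ : ζ(ρ) = 0, 0 ≤ Re ρ ≤ 1, T − √T ≤ Im ρ < 2T + √T}`
  (each zero once; multiplicity `m_ρ = riemannZetaZeroOrder ρ`; the closed conditions `0 ≤ Re ρ ≤ 1`
  are those of the tree's `zetaZeroBox` and add nothing, `ζ ≠ 0` on `Re s ∈ {0,1}`), a finite set
  (`nearZeros_finite`); `N(I′) = nearZeroCount T`; `G̃ = gramMatrix ψ T`, `P = onLineMatrix ψ T`,
  `Q = offLineMatrix ψ T` are `finsum`s over it (= `Finset` sums, `gramMatrix_eq_sum`).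
  `N(T,2T) = zetaZeroCount (2T) − zetaZeroCount T` (§1.1: `T < γ ≤ 2T`, the tree's convention).
* "`X = Y + O(E)` with constants depending on `χ, ψ`, `T` large" is spelled `∃ C T₀, ∀ T ≥ T₀,
  ‖X − Y‖ ≤ C·E` INSIDE `∀ ψ, IsWindow ψ → …` (complex norm; the traces are in fact real —
  proved in the companion file, not assumed).
* NOT typed here (by design): `Ẽ` and Proposition 4.3, Propositions 5.2–5.5 (internal to the proof
  of Theorem 5.7; they need the densities `μ, Π_X, P_X, ν_X` of (2.2) and the bilinear form `𝓜`),
  Remark 4.4. Proposition 4.1 and Corollary 4.5 are PROVED in `CriticalLineTwoThirdsMatrixProofs.lean`,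
  so they are not stated as facts (D-0026).
* Observation recorded, not used: §5.1's sandwich `1_{[−L/2+w, L/2−w]} ≤ φ² ≤ φ ≤ 1_{[−L/2,L/2]}`
  and "`0 ≤ φ ≤ 1`" (§2.2) presuppose `ψ ≤ 1 ≤ ψ` on the bulk, i.e. they are written for the flat
  window; for a general window (e.g. `ψ_MT ∈ [cos(1/√2), 1]`) the constants of (5.1)–(5.2) depend on
  `inf ψ`, `sup ψ`. This does not affect the statements typed here.

## Status note (one paragraph, no endorsement)

[AF26] is an unrefereed arXiv preprint (v1 13 Aug, v2 19 Aug 2026; arXiv listing re-read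
2026-08-27: no v3, no journal reference). Proposition 4.2 and Theorem 5.7 are its two second-moment
evaluations of the compressed form: the trace by the Poisson–Gabor identity (Lemma 2.1, a tree
theorem) plus a tail estimate, the Hilbert–Schmidt norm by Weil's explicit formula, Stirling,
Chebyshev–Mertens sums of `Λ²` (Lemma 5.1, tree theorems) and the Montgomery–Vaughan inequality
(Lemma 2.2, a tree theorem) — "Montgomery's unconditional prime-side second moment [Mon73, Ary22,
BGSTB24]" (§1.2 (P)). The authors report a sorry-free Lean 4 formalisation (App. A); this tree has
not replayed it (D-0040) and records both statements as claims. With them, Theorem A is a kernel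
consequence (companion file). Nothing here bears on the truth of RH.

## References

* [AF26] as above [key `AlpogeFurman2026`]; Montgomery 1973 [`Montgomery1973`].
-/

noncomputable section

open Complex Filter Set MeasureTheory Matrix
open scoped Real Topology

namespace Literature.NumberTheory.LFunctions

namespace AlpogeFurman2026

/-! ## §2.2: the window class, the ramp, the test function -/

/-- **[AF26] §2.2, the window class** (p. 4: "Fix an even window `ψ ∈ C²([−½,½])` with `ψ > 0` on
`[−½,½]`"): `ψ` is even, twice continuously differentiable on `[−½,½]`, and positive there. Only
the values of `ψ` on `[−½,½]` are ever used. [cite: AlpogeFurman2026, §2.2 (p. 4)] -/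
structure IsWindow (ψ : ℝ → ℝ) : Prop where
  even : ∀ u : ℝ, ψ (-u) = ψ u
  contDiffOn : ContDiffOn ℝ 2 ψ (Icc (-(1 / 2 : ℝ)) (1 / 2))
  pos : ∀ u ∈ Icc (-(1 / 2 : ℝ)) (1 / 2), 0 < ψ u

/-- **[AF26] §2.2, the ramp `χ`** (p. 4: "Fix `χ ∈ C^∞(ℝ)` nondecreasing, `χ|_{(−∞,0]} = 0`,
`χ|_{[1,∞)} = 1`"), INSTANTIATED as Mathlib's `Real.smoothTransition` (which is `C^∞`, monotone,
`0` on `(−∞,0]`, `1` on `[1,∞)`): the paper allows any such `χ` and lets all constants depend on it;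
we fix this one. [cite: AlpogeFurman2026, §2.2 (p. 4)] -/
def smoothRamp : ℝ → ℝ := Real.smoothTransition

/-- **[AF26] §2.2**: `L := l = log(T/2π)` (so `X := e^L = T/2π`), the common length scale of the test
function, the grid and the Dirichlet polynomial. [cite: AlpogeFurman2026, §1.7 and §2.2 (p. 4)] -/
def logHeight (T : ℝ) : ℝ := Real.log (T / (2 * π))

/-- The clamp `x ↦ max(−½, min(½, x))` onto `[−½,½]`, through which `phi` reads the window (so that
`ψ` matters only on `[−½,½]`). [cite: AlpogeFurman2026, §2.2 (p. 4)] -/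
def clampHalf (x : ℝ) : ℝ := max (-(1 / 2)) (min (1 / 2) x)

/-- **[AF26] §2.2 eq. (2.8), the test function** `φ(u) := χ(L/2 + u) χ(L/2 − u) · ψ(u/L)^{1/2}`
(`L = log(T/2π)`, `χ = smoothRamp`), with `ψ` read through the clamp onto `[−½,½]` — pointwise
equal to the printed `φ` because the ramp factor vanishes for `|u| ≥ L/2` (`phi_eq_printed`).
Even, continuous, supported in `(−L/2, L/2)` for a window (`phi_neg`, `continuous_phi`,
`support_phi`). [cite: AlpogeFurman2026, §2.2 eq. (2.8) (p. 4)] -/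
def phi (ψ : ℝ → ℝ) (T u : ℝ) : ℝ :=
  smoothRamp (logHeight T / 2 + u) * smoothRamp (logHeight T / 2 - u) *
    Real.sqrt (ψ (clampHalf (u / logHeight T)))

/-- **[AF26] §2.3**: `a := ‖φ‖₂²/L` (p. 4; "`= ∫_{−½}^{½} ψ + O_χ(L⁻¹)`"). [cite: AlpogeFurman2026, §2.3 (p. 4)] -/
def aConst (ψ : ℝ → ℝ) (T : ℝ) : ℝ :=
  (∫ u : ℝ, phi ψ T u ^ 2) / logHeight T

/-- **[AF26] §2.2**: `d := ⌊LT/(2π)⌋` (p. 4; "so `α_0, …, α_{d−1} ∈ [T,2T)` and `d = N(T,2T) + O(L)`"),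
the size of the compression. [cite: AlpogeFurman2026, §2.2 (p. 4)] -/
def gridDim (T : ℝ) : ℕ := ⌊logHeight T * T / (2 * π)⌋₊

/-- **[AF26] §1.2**: `γ_ρ := (ρ − ½)/i`, the spectral parameter of a zero (`Re γ_ρ = Im ρ`,
`Im γ_ρ = ½ − Re ρ`; real iff `ρ` is on the critical line). [cite: AlpogeFurman2026, §1.2 (p. 2)] -/
def gammaOf (ρ : ℂ) : ℂ := (ρ - 1 / 2) / I

/-- **[AF26] §2.2 eq. (2.10), the vector of a zero** `v_ρ := (φ̂(γ_ρ − α_k))_{0 ≤ k < d} ∈ ℂ^d`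
(`φ̂ = AlpogeFurman2026.hat`, `α_k = AlpogeFurman2026.grid T L k`, `d = gridDim T`).
[cite: AlpogeFurman2026, §2.2 eq. (2.10) (p. 4)] -/
def zeroVec (ψ : ℝ → ℝ) (T : ℝ) (ρ : ℂ) : Fin (gridDim T) → ℂ :=
  fun k ↦ hat (fun u ↦ (phi ψ T u : ℂ)) (gammaOf ρ - (grid T (logHeight T) ((k : ℕ) : ℤ) : ℂ))

/-! ## §2.3: the zeros seen by the window and the matrices `G̃, P, Q` -/

/-- **[AF26] §2.3, the zeros with `Re γ_ρ ∈ I′ = [T − √T, 2T + √T)`** (p. 4): the zeros `ρ` of `ζ`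
with `T − √T ≤ Im ρ < 2T + √T` (each listed once; the multiplicity is `riemannZetaZeroOrder ρ`).
The closed conditions `0 ≤ Re ρ ≤ 1` are those of `zetaZeroBox` and add nothing (no zeros on
`Re s ∈ {0,1}`); for `T > 1` every member has `Im ρ > 0`, hence `0 < Re ρ < 1`. Finite
(`nearZeros_finite`). [cite: AlpogeFurman2026, §2.3 (p. 4)] -/
def nearZeros (T : ℝ) : Set ℂ :=
  {ρ | riemannZeta ρ = 0 ∧ 0 ≤ ρ.re ∧ ρ.re ≤ 1 ∧ T - Real.sqrt T ≤ ρ.im ∧ ρ.im < 2 * T + Real.sqrt T}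

/-- The window's zero set is finite (it lies in a compact rectangle and the zeros of `ζ` are
discrete, `IsCompact.inter_riemannZetaZeros_finite`). [cite: AlpogeFurman2026, §2.3 (p. 4)] -/
theorem nearZeros_finite (T : ℝ) : (nearZeros T).Finite := by
  refine ((isCompact_Icc (a := (0 : ℝ)) (b := 1)).reProdIm
    (isCompact_Icc (a := T - Real.sqrt T) (b := 2 * T + Real.sqrt T))).inter_riemannZetaZeros_finite.subset
    ?_
  rintro ρ ⟨h0, h1, h2, h3, h4⟩
  exact ⟨Complex.mem_reProdIm.2 ⟨⟨h1, h2⟩, ⟨h3, h4.le⟩⟩, h0⟩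

/-- **[AF26] §2.3**: `N(I′) := Σ_{Re γ_ρ ∈ I′} m_ρ`, the zeros seen by the window counted with
multiplicity (a `finsum` of positive integers, read in `ℕ` like `zetaZeroCountRe`).
[cite: AlpogeFurman2026, §2.3 and Proposition 4.2 (pp. 4, 6)] -/
def nearZeroCount (T : ℝ) : ℕ :=
  (∑ᶠ ρ ∈ nearZeros T, riemannZetaZeroOrder ρ).toNat

/-- The normalising scalar `(aL²)⁻¹` of (2.11), as a complex number. [cite: AlpogeFurman2026, §2.3 eq. (2.11) (p. 4)] -/
def gramWeight (ψ : ℝ → ℝ) (T : ℝ) : ℂ :=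
  ((aConst ψ T * logHeight T ^ 2 : ℝ) : ℂ)⁻¹

/-- **[AF26] §2.3 eq. (2.11), the compressed Weil form**
`G̃ := (aL²)⁻¹ Σ_{Re γ_ρ ∈ I′} m_ρ v_ρ v_ρᵀ`, a `d × d` complex matrix (`v vᵀ = vecMulVec v v`,
transpose as printed; it is real symmetric by the functional-equation pairing — proved in the
companion file, not built in). [cite: AlpogeFurman2026, §2.3 eq. (2.11) (p. 4)] -/
def gramMatrix (ψ : ℝ → ℝ) (T : ℝ) : Matrix (Fin (gridDim T)) (Fin (gridDim T)) ℂ :=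
  gramWeight ψ T • ∑ᶠ ρ ∈ nearZeros T,
    (riemannZetaZeroOrder ρ : ℂ) • vecMulVec (zeroVec ψ T ρ) (zeroVec ψ T ρ)

/-- **[AF26] §2.3 eq. (2.11), the on-line part** `P := (aL²)⁻¹ Σ_{ρ ∈ on} m_ρ v_ρ v_ρᵀ`
(`on = {Re γ_ρ ∈ I′, β = ½}`). [cite: AlpogeFurman2026, §2.3 eq. (2.11) (p. 4)] -/
def onLineMatrix (ψ : ℝ → ℝ) (T : ℝ) : Matrix (Fin (gridDim T)) (Fin (gridDim T)) ℂ :=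
  gramWeight ψ T • ∑ᶠ ρ ∈ nearZeros T ∩ {ρ | ρ.re = 1 / 2},
    (riemannZetaZeroOrder ρ : ℂ) • vecMulVec (zeroVec ψ T ρ) (zeroVec ψ T ρ)

/-- **[AF26] §2.3 eq. (2.11), the off-line part** `Q := G̃ − P`. [cite: AlpogeFurman2026, §2.3 eq. (2.11) (p. 4)] -/
def offLineMatrix (ψ : ℝ → ℝ) (T : ℝ) : Matrix (Fin (gridDim T)) (Fin (gridDim T)) ℂ :=
  gramMatrix ψ T - onLineMatrix ψ T

/-! ## §1.2 (Z) / §6: the three kinds of zeros in the window and the simple-zero part `P₁` -/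

/-- The zeros seen by the window as a `Finset` (each zero once). [cite: AlpogeFurman2026, §2.3 (p. 4)] -/
def nearZeroFinset (T : ℝ) : Finset ℂ := (nearZeros_finite T).toFinset

/-- **[AF26] §1.2 (Z) / §6, `on₁`**: the SIMPLE on-line zeros in the window (`β = ½`, `m_ρ = 1`);
their number is `s₁`. [cite: AlpogeFurman2026, §1.2 (Z) (p. 2) and §6 (p. 12)] -/
def onSimple (T : ℝ) : Finset ℂ :=
  (nearZeroFinset T).filter fun ρ ↦ ρ.re = 1 / 2 ∧ riemannZetaZeroOrder ρ = 1

/-- **[AF26] §1.2 (Z) / §6, `on_{≥2}`**: the MULTIPLE on-line points in the window (`β = ½`,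
`m_ρ ≠ 1`, i.e. `m_ρ ≥ 2`); their number is `s₂`. [cite: AlpogeFurman2026, §1.2 (Z) (p. 2) and §6 (p. 12)] -/
def onMultiple (T : ℝ) : Finset ℂ :=
  (nearZeroFinset T).filter fun ρ ↦ ρ.re = 1 / 2 ∧ riemannZetaZeroOrder ρ ≠ 1

/-- **[AF26] §2.3 / §6, the off-line PAIRS** `{ρ, 1 − ρ̄}` in the window, represented by their member
with `β > ½`; their number is `p = ½ #off`. [cite: AlpogeFurman2026, §2.3 (p. 4) and §6 (p. 12)] -/
def offRight (T : ℝ) : Finset ℂ :=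
  (nearZeroFinset T).filter fun ρ ↦ 1 / 2 < ρ.re

/-- The other members `1 − ρ̄` (`β < ½`) of the off-line pairs. [cite: AlpogeFurman2026, §2.3 (p. 4)] -/
def offLeft (T : ℝ) : Finset ℂ :=
  (nearZeroFinset T).filter fun ρ ↦ ρ.re < 1 / 2

/-- **[AF26] §6, the simple-on-line part** `P₁ := (aL²)⁻¹ Σ_{ρ ∈ on₁} v_ρ v_ρᵀ` (p. 12: "Set
`P₁ := (aL²)⁻¹ Σ_{ρ ∈ on₁} v_ρ v_ρᵀ` (the simple on-line zeros) and `Q′ := G̃ − P₁`").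
[cite: AlpogeFurman2026, §6 proof of Theorem A (p. 12)] -/
def onSimpleMatrix (ψ : ℝ → ℝ) (T : ℝ) : Matrix (Fin (gridDim T)) (Fin (gridDim T)) ℂ :=
  gramWeight ψ T • ∑ ρ ∈ onSimple T, vecMulVec (zeroVec ψ T ρ) (zeroVec ψ T ρ)

end AlpogeFurman2026

open AlpogeFurman2026

/-! ## The two analytic evaluations consumed by §6 (claims) -/

/-- **[AF26] Proposition 4.2 (Trace)** (p. 6): "`tr G̃ = N(I′) + O_χ(T^{1/2} L²)`" — for every window
`ψ` (even, `C²`, `> 0` on `[−½,½]`) there are `C, T₀` with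
`|tr G̃ − N(I′)| ≤ C √T L²` for all `T ≥ T₀` (`L = log(T/2π)`; constants depending on `ψ` and on
the fixed ramp `χ = smoothRamp`, "Throughout §§4–6 the implied constants depend only on `χ` and `ψ`,
and we take `T` large"). Printed proof: Lemma 2.1 at `z = z′ = γ_ρ` gives
`tr(v_ρ v_ρᵀ) = aL² − Σ_{k ∉ [0,d)} φ̂(γ_ρ − α_k)²`, and the tail over `k ∉ [0,d)` is bounded by
(2.9) and integral comparison. UNCONDITIONAL as printed. Typed as a CLAIM of an unrefereed source;
since PROVED for this typed model — `AlpogeFurman2026_trace_holds` in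
`CriticalLineTwoThirdsTraceProofs.lean` — so users' `(h : AlpogeFurman2026_trace)` are fed by it.
[claim: AlpogeFurman2026, status: under-review] -/
def AlpogeFurman2026_trace : Prop :=
  ∀ ψ : ℝ → ℝ, IsWindow ψ → ∃ C T₀ : ℝ, ∀ T : ℝ, T₀ ≤ T →
    ‖(gramMatrix ψ T).trace - (nearZeroCount T : ℂ)‖ ≤
      C * Real.sqrt T * logHeight T ^ 2

/-- **[AF26] Theorem 5.7** (p. 11): "`‖G̃‖²_HS = (R(ψ) + O_χ(L⁻¹)) N(T,2T)`" — for every window `ψ`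
there are `C, T₀` with `|tr(G̃²) − R(ψ) N(T,2T)| ≤ C N(T,2T)/L` for all `T ≥ T₀`, where
`‖R‖²_HS = tr R²` (§1.7), `R(ψ) = windowConstant ψ` (Lemma 5.6, (5.10)), `N(T,2T) = N(2T) − N(T)`
(`zetaZeroCount`, zeros with `T < γ ≤ 2T` counted with multiplicity, §1.1) and `L = log(T/2π)`.
Printed proof: Propositions 5.2–5.5 (reduction to the double integral `𝓜[ν_X, ν_X]`, archimedean,
prime and cross terms), Lemma 5.6, Proposition 4.3 — "Montgomery's unconditional prime-side second
moment". UNCONDITIONAL as printed. Typed as a CLAIM of an unrefereed source; since PROVED for this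
typed model — `AlpogeFurman2026_hilbertSchmidt_holds` in `CriticalLineTwoThirdsHilbertSchmidtProofs.lean`
(with `CriticalLineTwoThirdsArchProofs`, `…PrimeTermProofs`, `…Reduction`, `…PrimeSideSetup`: the
printed proof, every `O(·)` an explicit constant) — so users' `(h : AlpogeFurman2026_hilbertSchmidt)`
are fed by it. [claim: AlpogeFurman2026, status: under-review] -/
def AlpogeFurman2026_hilbertSchmidt : Prop :=
  ∀ ψ : ℝ → ℝ, IsWindow ψ → ∃ C T₀ : ℝ, ∀ T : ℝ, T₀ ≤ T →
    ‖(gramMatrix ψ T * gramMatrix ψ T).trace -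
        (windowConstant ψ : ℂ) * ((zetaZeroCount (2 * T) : ℂ) - zetaZeroCount T)‖ ≤
      C * ((zetaZeroCount (2 * T) : ℝ) - zetaZeroCount T) / logHeight T

/-! ## Cheap API (proved) -/

namespace AlpogeFurman2026

/-! ### The ramp -/

/-- `χ = 0` on `(−∞, 0]`. [cite: AlpogeFurman2026, §2.2 (p. 4)] -/
theorem smoothRamp_of_nonpos {x : ℝ} (hx : x ≤ 0) : smoothRamp x = 0 :=
  Real.smoothTransition.zero_of_nonpos hx

/-- `χ = 1` on `[1, ∞)`. [cite: AlpogeFurman2026, §2.2 (p. 4)] -/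
theorem smoothRamp_of_one_le {x : ℝ} (hx : 1 ≤ x) : smoothRamp x = 1 :=
  Real.smoothTransition.one_of_one_le hx

/-- `0 < χ(x)` for `x > 0`. [cite: AlpogeFurman2026, §2.2 (p. 4)] -/
theorem smoothRamp_pos {x : ℝ} (hx : 0 < x) : 0 < smoothRamp x :=
  Real.smoothTransition.pos_of_pos hx

/-- `0 ≤ χ ≤ 1`. [cite: AlpogeFurman2026, §2.2 (p. 4)] -/
theorem smoothRamp_nonneg (x : ℝ) : 0 ≤ smoothRamp x := Real.smoothTransition.nonneg x

/-- `χ ≤ 1`. [cite: AlpogeFurman2026, §2.2 (p. 4)] -/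
theorem smoothRamp_le_one (x : ℝ) : smoothRamp x ≤ 1 := Real.smoothTransition.le_one x

/-- `χ` is nondecreasing. [cite: AlpogeFurman2026, §2.2 (p. 4)] -/
theorem smoothRamp_monotone : Monotone smoothRamp := Real.smoothTransition.monotone

/-- `χ ∈ C^∞`. [cite: AlpogeFurman2026, §2.2 (p. 4)] -/
theorem contDiff_smoothRamp {n : ℕ∞} : ContDiff ℝ n smoothRamp := Real.smoothTransition.contDiff

/-- `χ` is continuous. [cite: AlpogeFurman2026, §2.2 (p. 4)] -/
theorem continuous_smoothRamp : Continuous smoothRamp := Real.smoothTransition.continuous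

/-! ### The clamp -/

/-- The clamp lands in `[−½, ½]`. [cite: AlpogeFurman2026, §2.2 (p. 4)] -/
theorem clampHalf_mem (x : ℝ) : clampHalf x ∈ Icc (-(1 / 2 : ℝ)) (1 / 2) := by
  refine ⟨le_max_left _ _, max_le (by norm_num) (min_le_left _ _)⟩

/-- The clamp is the identity on `[−½, ½]`. [cite: AlpogeFurman2026, §2.2 (p. 4)] -/
theorem clampHalf_of_mem {x : ℝ} (hx : x ∈ Icc (-(1 / 2 : ℝ)) (1 / 2)) : clampHalf x = x := by
  rw [clampHalf, min_eq_right hx.2, max_eq_right hx.1]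

/-- The clamp is odd. [cite: AlpogeFurman2026, §2.2 (p. 4)] -/
theorem clampHalf_neg (x : ℝ) : clampHalf (-x) = -clampHalf x := by
  simp only [clampHalf, max_def, min_def]
  split_ifs <;> linarith

/-- The clamp is continuous. [cite: AlpogeFurman2026, §2.2 (p. 4)] -/
theorem continuous_clampHalf : Continuous clampHalf :=
  continuous_const.max (continuous_const.min continuous_id)

/-! ### The test function `φ` -/

/-- `φ` vanishes for `|u| ≥ L/2` (one ramp factor is `χ(L/2 − |u|) = 0`).
[cite: AlpogeFurman2026, §2.2 (p. 4: "`supp φ = [−L/2, L/2]`")] -/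
theorem phi_eq_zero_of_le_abs {ψ : ℝ → ℝ} {T u : ℝ} (hu : logHeight T / 2 ≤ |u|) :
    phi ψ T u = 0 := by
  unfold phi
  rcases le_or_gt 0 u with h | h
  · rw [abs_of_nonneg h] at hu
    rw [smoothRamp_of_nonpos (by linarith : logHeight T / 2 - u ≤ 0)]
    simp
  · rw [abs_of_neg h] at hu
    rw [smoothRamp_of_nonpos (by linarith : logHeight T / 2 + u ≤ 0)]
    simp

/-- **Faithfulness of the clamp**: for `L > 0`, `φ(u) = χ(L/2 + u) χ(L/2 − u) ψ(u/L)^{1/2}` for EVERY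
`u` — the printed formula (2.8) verbatim (for `|u| < L/2` the clamp is inactive, for `|u| ≥ L/2`
both sides vanish). [cite: AlpogeFurman2026, §2.2 eq. (2.8) (p. 4)] -/
theorem phi_eq_printed {ψ : ℝ → ℝ} {T : ℝ} (hL : 0 < logHeight T) (u : ℝ) :
    phi ψ T u = smoothRamp (logHeight T / 2 + u) * smoothRamp (logHeight T / 2 - u) *
      Real.sqrt (ψ (u / logHeight T)) := by
  rcases lt_or_ge |u| (logHeight T / 2) with h | h
  · have hmem : u / logHeight T ∈ Icc (-(1 / 2 : ℝ)) (1 / 2) := by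
      rw [abs_lt] at h
      constructor
      · rw [le_div_iff₀ hL]; linarith
      · rw [div_le_iff₀ hL]; linarith
    rw [phi, clampHalf_of_mem hmem]
  · rw [phi_eq_zero_of_le_abs h]
    rcases le_or_gt 0 u with h' | h'
    · rw [abs_of_nonneg h'] at h
      rw [smoothRamp_of_nonpos (by linarith : logHeight T / 2 - u ≤ 0)]
      simp
    · rw [abs_of_neg h'] at h
      rw [smoothRamp_of_nonpos (by linarith : logHeight T / 2 + u ≤ 0)]
      simp

/-- `φ` is even (for an even window). [cite: AlpogeFurman2026, §2.2 (p. 4: "`φ` … is even")] -/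
theorem phi_neg {ψ : ℝ → ℝ} (heven : ∀ u, ψ (-u) = ψ u) (T u : ℝ) :
    phi ψ T (-u) = phi ψ T u := by
  unfold phi
  rw [neg_div, clampHalf_neg, heven]
  ring_nf

/-- `φ ≥ 0`. [cite: AlpogeFurman2026, §2.2 (p. 4: "`0 ≤ φ`")] -/
theorem phi_nonneg (ψ : ℝ → ℝ) (T u : ℝ) : 0 ≤ phi ψ T u :=
  mul_nonneg (mul_nonneg (smoothRamp_nonneg _) (smoothRamp_nonneg _)) (Real.sqrt_nonneg _)

/-- `φ ≤ (sup_{[−½,½]} ψ)^{1/2}` pointwise; in particular `φ ≤ 1` when `ψ ≤ 1` on `[−½,½]` (the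
printed "`0 ≤ φ ≤ 1`" is the flat-window normalisation). [cite: AlpogeFurman2026, §2.2 (p. 4)] -/
theorem phi_le_sqrt {ψ : ℝ → ℝ} {M : ℝ} (hM : ∀ x ∈ Icc (-(1 / 2 : ℝ)) (1 / 2), ψ x ≤ M) (T u : ℝ) :
    phi ψ T u ≤ Real.sqrt M := by
  unfold phi
  have h1 : smoothRamp (logHeight T / 2 + u) * smoothRamp (logHeight T / 2 - u) ≤ 1 := by
    calc smoothRamp (logHeight T / 2 + u) * smoothRamp (logHeight T / 2 - u) ≤ 1 * 1 :=
          mul_le_mul (smoothRamp_le_one _) (smoothRamp_le_one _) (smoothRamp_nonneg _) zero_le_one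
      _ = 1 := one_mul 1
  calc smoothRamp (logHeight T / 2 + u) * smoothRamp (logHeight T / 2 - u) *
        Real.sqrt (ψ (clampHalf (u / logHeight T)))
      ≤ 1 * Real.sqrt M := by
        refine mul_le_mul h1 (Real.sqrt_le_sqrt (hM _ (clampHalf_mem _)))
          (Real.sqrt_nonneg _) zero_le_one
    _ = Real.sqrt M := one_mul _

/-- The support of `φ` is exactly `(−L/2, L/2)` for a window positive on `[−½,½]` and `L > 0`
(the printed "`supp φ = [−L/2, L/2]`" is its closure). [cite: AlpogeFurman2026, §2.2 (p. 4)] -/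
theorem support_phi {ψ : ℝ → ℝ} (hpos : ∀ u ∈ Icc (-(1 / 2 : ℝ)) (1 / 2), 0 < ψ u) {T : ℝ}
    (hL : 0 < logHeight T) :
    Function.support (phi ψ T) = Ioo (-(logHeight T / 2)) (logHeight T / 2) := by
  ext u
  simp only [Function.mem_support, ne_eq, mem_Ioo]
  constructor
  · intro h
    by_contra hu
    apply h
    apply phi_eq_zero_of_le_abs
    rw [not_and_or, not_lt, not_lt] at hu
    rcases hu with hu | hu
    · rw [abs_of_nonpos (by linarith)]; linarith
    · rw [abs_of_nonneg (by linarith)]; exact hu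
  · rintro ⟨h1, h2⟩
    unfold phi
    refine mul_ne_zero (mul_ne_zero (smoothRamp_pos (by linarith)).ne' (smoothRamp_pos (by linarith)).ne')
      ?_
    exact (Real.sqrt_pos.2 (hpos _ (clampHalf_mem _))).ne'

/-- The support of `φ` lies in `(−L/2, L/2)` (the hypothesis shape of the Gabor lemmas of
`GaborCriticalDensityPoisson.lean`), for ANY `ψ`. [cite: AlpogeFurman2026, §2.2 (p. 4)] -/
theorem support_phi_subset (ψ : ℝ → ℝ) (T : ℝ) :
    Function.support (phi ψ T) ⊆ Ioo (-(logHeight T / 2)) (logHeight T / 2) := by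
  intro u hu
  rw [Function.mem_support] at hu
  by_contra h
  apply hu
  apply phi_eq_zero_of_le_abs
  rw [mem_Ioo, not_and_or, not_lt, not_lt] at h
  rcases h with h | h
  · calc logHeight T / 2 ≤ -u := by linarith
      _ ≤ |u| := neg_le_abs u
  · calc logHeight T / 2 ≤ u := h
      _ ≤ |u| := le_abs_self u

/-- `φ` is continuous (for a window: `ψ` is continuous on `[−½,½]`, read through the continuous
clamp). [cite: AlpogeFurman2026, §2.2 (p. 4: "`φ ∈ C²_c(ℝ)`")] -/
theorem continuous_phi {ψ : ℝ → ℝ} (hcont : ContinuousOn ψ (Icc (-(1 / 2 : ℝ)) (1 / 2))) (T : ℝ) :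
    Continuous (phi ψ T) := by
  unfold phi
  have h1 : Continuous fun u : ℝ ↦ ψ (clampHalf (u / logHeight T)) := by
    have hc : Continuous fun u : ℝ ↦ clampHalf (u / logHeight T) :=
      continuous_clampHalf.comp (continuous_id.div_const _)
    exact hcont.comp_continuous hc fun u ↦ clampHalf_mem _
  exact ((continuous_smoothRamp.comp (continuous_const.add continuous_id)).mul
    (continuous_smoothRamp.comp (continuous_const.sub continuous_id))).mul h1.sqrt

/-- A window is continuous on `[−½,½]`. [cite: AlpogeFurman2026, §2.2 (p. 4)] -/
theorem IsWindow.continuousOn {ψ : ℝ → ℝ} (hψ : IsWindow ψ) :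
    ContinuousOn ψ (Icc (-(1 / 2 : ℝ)) (1 / 2)) :=
  hψ.contDiffOn.continuousOn

/-- For a window, `φ` is continuous. [cite: AlpogeFurman2026, §2.2 (p. 4)] -/
theorem IsWindow.continuous_phi {ψ : ℝ → ℝ} (hψ : IsWindow ψ) (T : ℝ) : Continuous (phi ψ T) :=
  AlpogeFurman2026.continuous_phi hψ.continuousOn T

/-- `φ` has compact support (it vanishes off `[−L/2, L/2]`). [cite: AlpogeFurman2026, §2.2 (p. 4)] -/
theorem hasCompactSupport_phi (ψ : ℝ → ℝ) (T : ℝ) : HasCompactSupport (phi ψ T) :=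
  HasCompactSupport.intro (isCompact_Icc (a := -(logHeight T / 2)) (b := logHeight T / 2))
    fun u hu ↦ by
      by_contra h
      exact hu (Ioo_subset_Icc_self (support_phi_subset ψ T (Function.mem_support.2 h)))

/-! ### The two printed windows are windows -/

/-- The flat window `ψ₀ = 1` on `[−½,½]` ((2.7)) is a window. [cite: AlpogeFurman2026, §2.2 eq. (2.7) (p. 4)] -/
theorem isWindow_one : IsWindow fun _ ↦ (1 : ℝ) where
  even := fun _ ↦ rfl
  contDiffOn := contDiffOn_const
  pos := fun _ _ ↦ one_pos

/-- The Montgomery–Taylor window `ψ_MT(s) = cos(√2 s)` ((2.7); `montgomeryTaylorWindow`) is a window: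
even, smooth, and positive on `[−½,½]` since `√2/2 < π/2`. [cite: AlpogeFurman2026, §2.2 eq. (2.7) (p. 4)] -/
theorem isWindow_montgomeryTaylor : IsWindow montgomeryTaylorWindow where
  even := fun u ↦ by simp [montgomeryTaylorWindow, Real.cos_neg]
  contDiffOn := by
    have : ContDiff ℝ 2 montgomeryTaylorWindow := by
      unfold montgomeryTaylorWindow
      fun_prop
    exact this.contDiffOn
  pos := by
    intro u hu
    unfold montgomeryTaylorWindow
    have h2 : Real.sqrt 2 < 2 := by
      rw [show (2 : ℝ) = Real.sqrt 4 by rw [show (4 : ℝ) = 2 ^ 2 by norm_num, Real.sqrt_sq (by norm_num)]]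
      exact Real.sqrt_lt_sqrt (by norm_num) (by norm_num)
    have hπ := Real.pi_gt_three
    have hb : |Real.sqrt 2 * u| < π / 2 := by
      rw [abs_mul, abs_of_nonneg (Real.sqrt_nonneg _)]
      have : |u| ≤ 1 / 2 := abs_le.2 ⟨hu.1, hu.2⟩
      nlinarith [abs_nonneg u, Real.sqrt_nonneg 2]
    exact Real.cos_pos_of_mem_Ioo ⟨by linarith [(abs_lt.1 hb).1], (abs_lt.1 hb).2⟩

/-! ### The spectral parameter -/

/-- `Re γ_ρ = Im ρ` and `Im γ_ρ = ½ − Re ρ`. [cite: AlpogeFurman2026, §1.2 (p. 2)] -/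
theorem gammaOf_re_im (ρ : ℂ) : (gammaOf ρ).re = ρ.im ∧ (gammaOf ρ).im = 1 / 2 - ρ.re := by
  have h : gammaOf ρ = -I * (ρ - 1 / 2) := by
    rw [gammaOf, div_eq_mul_inv, Complex.inv_I]; ring
  rw [h]
  constructor
  · simp [Complex.mul_re]
  · simp [Complex.mul_im]

/-- On the critical line the spectral parameter is the (real) ordinate: `Re ρ = ½ ⇒ γ_ρ = Im ρ`.
[cite: AlpogeFurman2026, Proposition 4.1 (proof: "For `ρ ∈ on`, `γ_ρ ∈ ℝ`"), p. 6] -/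
theorem gammaOf_of_re_eq_half {ρ : ℂ} (h : ρ.re = 1 / 2) : gammaOf ρ = (ρ.im : ℂ) := by
  apply Complex.ext
  · rw [(gammaOf_re_im ρ).1, Complex.ofReal_re]
  · rw [(gammaOf_re_im ρ).2, Complex.ofReal_im, h]; norm_num

/-- The functional-equation partner has the conjugate parameter: `γ_{1−ρ̄} = conj γ_ρ`.
[cite: AlpogeFurman2026, §2.3 (p. 4: "The functional equation pairs `off` as `{ρ, 1 − ρ̄}`")] -/
theorem gammaOf_one_sub_conj (ρ : ℂ) :
    gammaOf (1 - (starRingEnd ℂ) ρ) = (starRingEnd ℂ) (gammaOf ρ) := by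
  apply Complex.ext
  · rw [(gammaOf_re_im _).1, Complex.conj_re, (gammaOf_re_im ρ).1]
    simp
  · rw [(gammaOf_re_im _).2, Complex.conj_im, (gammaOf_re_im ρ).2]
    simp
    ring

/-! ### The zero set of the window -/

/-- For `T > 1` (so `T − √T > 0`) every zero seen by the window has positive ordinate, hence lies
in the open strip `0 < Re ρ < 1`. [cite: AlpogeFurman2026, §2.3 (p. 4)] -/
theorem im_pos_of_mem_nearZeros {T : ℝ} (hT : 1 < T) {ρ : ℂ} (hρ : ρ ∈ nearZeros T) : 0 < ρ.im := by
  obtain ⟨-, -, -, h3, -⟩ := hρ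
  have h1 : Real.sqrt T < T := by
    have hs : Real.sqrt T * Real.sqrt T = T := Real.mul_self_sqrt (by linarith)
    have h1' : 1 < Real.sqrt T := by
      rw [show (1 : ℝ) = Real.sqrt 1 by simp]
      exact Real.sqrt_lt_sqrt (by norm_num) hT
    nlinarith
  linarith

/-- For `T > 1` the window's zeros lie in the open critical strip. [cite: AlpogeFurman2026, §2.3 (p. 4)] -/
theorem re_mem_Ioo_of_mem_nearZeros {T : ℝ} (hT : 1 < T) {ρ : ℂ} (hρ : ρ ∈ nearZeros T) :
    0 < ρ.re ∧ ρ.re < 1 :=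
  re_mem_Ioo_of_riemannZeta_eq_zero_of_im_ne_zero hρ.1 (im_pos_of_mem_nearZeros hT hρ).ne'

/-- For `T > 1` the window's zeros lie in the counting box `zetaZeroBox 0 (2T + √T)`.
[cite: AlpogeFurman2026, §2.3 (p. 4)] -/
theorem nearZeros_subset_zetaZeroBox {T : ℝ} (hT : 1 < T) :
    nearZeros T ⊆ zetaZeroBox 0 (2 * T + Real.sqrt T) := fun _ hρ ↦
  ⟨hρ.1, hρ.2.1, hρ.2.2.1, im_pos_of_mem_nearZeros hT hρ, hρ.2.2.2.2.le⟩

/-- Multiplicities are positive on the window's zero set (`T > 1`). [cite: AlpogeFurman2026, §2.3 (p. 4)] -/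
theorem riemannZetaZeroOrder_pos_of_mem_nearZeros {T : ℝ} (hT : 1 < T) {ρ : ℂ}
    (hρ : ρ ∈ nearZeros T) : 0 < riemannZetaZeroOrder ρ :=
  DiophantineGeometry.riemannZetaZeroOrder_pos_of_mem_zetaZeroBox (nearZeros_subset_zetaZeroBox hT hρ)

/-- Membership in the window's finite zero set. [cite: AlpogeFurman2026, §2.3 (p. 4)] -/
theorem mem_nearZeroFinset {T : ℝ} {ρ : ℂ} : ρ ∈ nearZeroFinset T ↔ ρ ∈ nearZeros T := by
  rw [nearZeroFinset, Set.Finite.mem_toFinset]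

/-- `N(I′)` as a `Finset` sum over the window's zeros (`T > 1`). [cite: AlpogeFurman2026, Proposition 4.2 (p. 6)] -/
theorem nearZeroCount_eq_sum {T : ℝ} (hT : 1 < T) :
    (nearZeroCount T : ℤ) = ∑ ρ ∈ nearZeroFinset T, riemannZetaZeroOrder ρ := by
  rw [nearZeroCount, finsum_mem_eq_finite_toFinset_sum _ (nearZeros_finite T), nearZeroFinset]
  exact Int.toNat_of_nonneg (Finset.sum_nonneg fun ρ hρ ↦
    (riemannZetaZeroOrder_pos_of_mem_nearZeros hT ((Set.Finite.mem_toFinset _).1 hρ)).le)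

/-- `G̃` as a `Finset` sum. [cite: AlpogeFurman2026, §2.3 eq. (2.11) (p. 4)] -/
theorem gramMatrix_eq_sum (ψ : ℝ → ℝ) (T : ℝ) :
    gramMatrix ψ T = gramWeight ψ T • ∑ ρ ∈ nearZeroFinset T,
      (riemannZetaZeroOrder ρ : ℂ) • vecMulVec (zeroVec ψ T ρ) (zeroVec ψ T ρ) := by
  rw [gramMatrix, finsum_mem_eq_finite_toFinset_sum _ (nearZeros_finite T), nearZeroFinset]

/-- `P` as a `Finset` sum (over the filtered finite zero set). [cite: AlpogeFurman2026, §2.3 eq. (2.11) (p. 4)] -/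
theorem onLineMatrix_eq_sum (ψ : ℝ → ℝ) (T : ℝ) :
    onLineMatrix ψ T = gramWeight ψ T •
      ∑ ρ ∈ (nearZeroFinset T).filter (fun ρ ↦ ρ.re = 1 / 2),
        (riemannZetaZeroOrder ρ : ℂ) • vecMulVec (zeroVec ψ T ρ) (zeroVec ψ T ρ) := by
  have hfin : (nearZeros T ∩ {ρ | ρ.re = 1 / 2}).Finite := (nearZeros_finite T).inter_of_left _
  rw [onLineMatrix, finsum_mem_eq_finite_toFinset_sum _ hfin]
  congr 1
  apply Finset.sum_congr _ fun _ _ ↦ rfl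
  ext ρ
  simp [Set.Finite.mem_toFinset, Finset.mem_filter, nearZeroFinset]

/-- `G̃ = P + Q` by definition. [cite: AlpogeFurman2026, §2.3 eq. (2.11) (p. 4)] -/
theorem gramMatrix_eq_onLine_add_offLine (ψ : ℝ → ℝ) (T : ℝ) :
    gramMatrix ψ T = onLineMatrix ψ T + offLineMatrix ψ T := by
  rw [offLineMatrix, add_sub_cancel]

end AlpogeFurman2026

end Literature.NumberTheory.LFunctions

end
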